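import Summits.ABC.IUTFork.Repair.RHHeightClassKLineLaw
import Literature.IUT.LogVolume.Corollary22PartIIPointwise
import Literature.IUT.LogVolume.Corollary22LegendreDeepAdmissiblePairs
import Mathlib.Analysis.SpecialFunctions.Log.Basic
import HarnessLib

/-!
# R-H row 8 «heightclass» — the K-LINE l-WINDOW IS EMPTY FOR EVERY k (D-0121 Q2 «L-WINDOW», by-name complement of the finite bed table)
Seat abc-iut-rh-typ-8 gen 11; rung LADDER-ABC:A2.RESCUE.H. PROOF-ONLY (0 definitions). Companion of `RHHeightClassKLineLaw` (p479276: the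
two-sided exponential law `kline_in_of_pow_le` / `kline_out_of_lt`, which carries the side condition `3T + 4 ≤ l⋆`).
(1) `k_le_of_topCell` — a SIDE-CONDITION-FREE LINEAR LAW: in the K-line cell model of record (`p = 7 < l` prime, `e_w = l·ε`, `m_q = k·ε`,
`l⋆ = l/2`; `RHHeightClassKLine` p476616) the row-8 top cell «`(l⋆²−1)·kε ≤ l⋆(e_w − r♯) + 1 − r♯`» at the untied `r♯(7, l·ε)` (which EXISTS,
`exists_strictMinPow_kline`, and satisfies `r♯ ≥ −(l·ε)²` by `strictMinPow_ge_neg_of_lt` with `T = l·ε`) forces `k ≤ 3·l·ε + 3` — for EVERY `k`, `l ≥ 11`,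
`ε ≥ 1`, no window hypothesis («λ_k ∈ Σ₈ at l ⟹ l ≥ (k − 3)/(3ε)»).
(2) `klineHeight_lt` — the K-line height column of the Q3 numerics pens (abc-iut-rh2-q3-num Q3-HEX files / abc-iut-rh-num-1 Q3-LWINDOW f4ed31c292e2a89f:
«h_k = 2k·ln 7 + 2·ln(7^{2k} − 16)», their stated upper bound for `log q^{∤2}` of the datum λ_k) is `< 36·k` (`log 7 ≤ 6`, `log(7^{2k} − 16) < 2k·log 7`).
(3) `kline_window_empty` — hence for `ε ≤ 30` (the strip of record: `ε ∣ 30`), EVERY `k ≥ 1`, EVERY prime `l ≥ 11` and every `d ≥ 1`: top-cell membership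
⟹ `h_k < 120·(2¹²·3³·5·d)·l` — the l-linear term of the content-locus certificate (`Conditional/AbcExpOfSigmaMassContent` hypothesis shape
`… + 120 * (2 ^ 12 * 3 ^ 3 * 5 * dmod * l) < logQAvoid`) alone exceeds the height: the door-8 ∧ content-locus l-window is EMPTY on the whole K-line
family, the one family of the tabulated universe with UNBOUNDED height — the ∀k statement no finite table reaches (rh-num-1 B23: EMPTY 253/253, gap ≥ 7.1·10⁶;
rh2-q3-num: l₀⁸(k) to k = 100). (4) `kline_window_empty_of_k_le` — for `k ≤ 2·10⁷` no membership hypothesis is even needed (`36k < 120·552960·11`).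
(5) `kline_not_hregC_shape` — the same, packaged as the NEGATION of the certificate's l-side hypothesis shape for any `logQ ≤ h_k` and any
nonnegative leading term, for citation BY NAME. (6) `kline_window_empty_ratPoint` — the GENUINE-DATUM form: under the same membership hypothesis the
bare l-linear term exceeds `log q^{∤{2,l}}` OF THE POINT `ratPoint λ_k`, `λ_k = 1/2 + 2/7^k` (upstream Literature only: abc-iut-w5-d044's
`Cor22.logQForall_ratPoint_lamSeven_le` + `Cor22.logQAvoid_le_logQNotTwo_le`, `Cor22.dmod_pos`), i.e. no table column is read at all.
TWIN ROUTE, BY NAME (abc-iut-rh-lead g3 R31 2026-08-27T02:52:47Z «two independent kernel routes to the same emptiness, both may land»): abc-iut-lwin-typ-1's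
`Repair/RHLWindowKLine.lean` (`RH.LWindowTable.kline_lwindow_empty`, content-first: `le_of_content_ratPoint_lamSeven` gives `k ≥ 5 529 600·l`, then
`kline_out_of_le` kills the top cell with `T = 30l`) states the window as ¬(«in Σ₈ at l» ∧ «content at (λ_k, l)»); THIS file goes membership-first through
the side-condition-free linear law (`k ≤ 3lε + 3`, `T = lε`) and concludes the bare inequality «l-linear term > height»; neither file restates the other.
HONEST SCOPE: cell-model level (as the whole K-line column `lambda<k>_sigma8_iff`); the identification
of `h_k` with the datum's `log q^{∤2}` and of `(e_w, m_q) = (l·ε, k·ε)` with λ_k's place over 7 is the numerics pens' column definition (computed ≠ proved).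
TAKES NO SIDE on [IUTchIII] Cor. 3.12 / [IUTchIV] Thm 1.10 or on any author; nothing here asserts abc; `StrictMinPow` and the top cell are row 8's
CANDIDATE vocabulary (hypotheses). [claim: Mochizuki2012, status: disputed] for the reading; every statement below is [folklore] arithmetic.
-/

namespace Summit.ABC.IUTFork.Repair.RHHeightClass.KLine

open Summit.ABC.IUTFork.Repair.RHHeightClass

/-- **LINEAR LAW, no side condition (every k, l, ε).** `l ≥ 11` prime, `ε ≥ 1`: if the row-8 top cell holds at the untied `r♯(7, l·ε)`
(«λ_k ∈ Σ₈ at l» in the K-line cell model), then `k ≤ 3·l·ε + 3`. Proof: `r♯` exists (`exists_strictMinPow_kline`), `r♯ ≥ −(lε)²`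
(`strictMinPow_ge_neg_of_lt` with `T = lε`, as `lε < 7^{lε}`), and with `l⋆ = l/2 ≥ 5` the cell inequality is violated as soon as
`k ≥ 3lε + 4` (the cubic `2l⋆³ − 5l⋆² − 11l⋆ − 4 ≥ 66`). [folklore] -/
theorem k_le_of_topCell {l ε : ℕ} {k : ℤ} (hl : l.Prime) (h11 : 11 ≤ l) (hε : 1 ≤ ε)
    (hmem : ∀ r : ℤ, StrictMinPow 7 (l * ε) r →
      ((((l / 2 : ℕ) : ℤ)) ^ 2 - 1) * (k * ε) ≤ ((l / 2 : ℕ) : ℤ) * (((l * ε : ℕ) : ℤ) - r) + (1 - r)) :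
    k ≤ 3 * (l : ℤ) * ε + 3 := by
  obtain ⟨r, hr⟩ := exists_strictMinPow_kline (p := 7) (by norm_num) hl (by omega) ε
  have hcell := hmem r hr
  -- lower bound on the untied minimum: r ≥ −(lε)·(lε)
  have hlt : l * ε < 7 ^ (l * ε) := Nat.lt_pow_self (by norm_num)
  have hT : ((l * ε : ℕ) : ℤ) < (7 : ℤ) ^ (l * ε) * ((7 : ℤ) - 1) := by
    have h1 : ((l * ε : ℕ) : ℤ) < ((7 ^ (l * ε) : ℕ) : ℤ) := by exact_mod_cast hlt
    have h2 : (0 : ℤ) ≤ ((7 ^ (l * ε) : ℕ) : ℤ) := by positivity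
    push_cast at h1 h2 ⊢
    nlinarith
  have hrlo := strictMinPow_ge_neg_of_lt (p := 7) (T := l * ε) (by norm_num) hr (by exact_mod_cast hT)
  -- notation-free algebra: L = l/2 ≥ 5, l = 2L+1, e = (2L+1)ε
  have hodd : l % 2 = 1 := Nat.odd_iff.1 (hl.odd_of_ne_two (by omega))
  have hL5 : (5 : ℤ) ≤ ((l / 2 : ℕ) : ℤ) := by
    have : 5 ≤ l / 2 := by omega
    exact_mod_cast this
  have hl2 : (l : ℤ) = 2 * ((l / 2 : ℕ) : ℤ) + 1 := by omega
  have he : ((l * ε : ℕ) : ℤ) = (2 * ((l / 2 : ℕ) : ℤ) + 1) * ε := by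
    have h1 : ((l * ε : ℕ) : ℤ) = (l : ℤ) * ε := by push_cast; ring
    rw [h1, hl2]
  have hε' : (1 : ℤ) ≤ (ε : ℤ) := by exact_mod_cast hε
  rw [he] at hcell hrlo
  rw [hl2]
  set L : ℤ := ((l / 2 : ℕ) : ℤ) with hLdef
  set E : ℤ := (ε : ℤ) with hEdef
  by_contra hk
  push Not at hk
  -- k ≥ 3(2L+1)E + 4
  have hk4 : 3 * (2 * L + 1) * E + 4 ≤ k := by omega
  have hLE : (0 : ℤ) ≤ (L ^ 2 - 1) * E := by nlinarith
  have hkmul : (3 * (2 * L + 1) * E + 4) * ((L ^ 2 - 1) * E) ≤ k * ((L ^ 2 - 1) * E) :=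
    mul_le_mul_of_nonneg_right hk4 hLE
  -- RHS bound: L(e − r) + 1 − r ≤ L e + 1 + (L+1) e²
  have hr' : -r ≤ ((2 * L + 1) * E) * ((2 * L + 1) * E) := by
    have := hrlo
    nlinarith
  have hL0 : (0 : ℤ) ≤ L := by omega
  have hRHS : L * ((2 * L + 1) * E - r) + (1 - r) ≤
      L * ((2 * L + 1) * E) + 1 + (L + 1) * (((2 * L + 1) * E) * ((2 * L + 1) * E)) := by
    nlinarith
  have hmain : (3 * (2 * L + 1) * E + 4) * ((L ^ 2 - 1) * E) ≤
      L * ((2 * L + 1) * E) + 1 + (L + 1) * (((2 * L + 1) * E) * ((2 * L + 1) * E)) := by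
    calc (3 * (2 * L + 1) * E + 4) * ((L ^ 2 - 1) * E) ≤ k * ((L ^ 2 - 1) * E) := hkmul
      _ = (L ^ 2 - 1) * (k * E) := by ring
      _ ≤ L * ((2 * L + 1) * E - r) + (1 - r) := hcell
      _ ≤ _ := hRHS
  -- the cubic: (2L³ − 5L² − 11L − 4)E² + (2L² − L − 4)E − 1 > 0 for L ≥ 5, E ≥ 1
  have ha : (0 : ℤ) ≤ L - 5 := by omega
  have hb : (0 : ℤ) ≤ E - 1 := by omega
  nlinarith [mul_nonneg ha hb, mul_nonneg (mul_nonneg ha ha) hb, mul_nonneg (mul_nonneg ha ha) (mul_nonneg hb hb),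
    mul_nonneg (mul_nonneg (mul_nonneg ha ha) ha) (mul_nonneg hb hb), mul_nonneg ha (mul_nonneg hb hb),
    mul_nonneg (mul_nonneg ha hb) hb, mul_nonneg hb hb, mul_nonneg (mul_nonneg (mul_nonneg ha ha) ha) hb]

/-- **The K-line height column is `< 36·k`.** For `k ≥ 1`: `2k·log 7 + 2·log(7^{2k} − 16) < 36·k`, from `log 7 ≤ 7 − 1` and
`0 < 7^{2k} − 16 < 7^{2k}` (so `log(7^{2k} − 16) < 2k·log 7`). `h_k = 2k·ln 7 + 2·ln(7^{2k} − 16)` is the numerics pens' height column of the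
K-line datum λ_k (computed ≠ proved; the theorem is about the displayed real number only). [folklore] -/
theorem klineHeight_lt {k : ℕ} (hk : 1 ≤ k) :
    2 * (k : ℝ) * Real.log 7 + 2 * Real.log ((7 : ℝ) ^ (2 * k) - 16) < 36 * k := by
  have hlog7 : Real.log 7 ≤ 6 := by
    have := Real.log_le_sub_one_of_pos (show (0 : ℝ) < 7 by norm_num)
    linarith
  have hlog7pos : 0 < Real.log 7 := Real.log_pos (by norm_num)
  have hpow : (49 : ℝ) ≤ (7 : ℝ) ^ (2 * k) := by
    have h1 : (7 : ℝ) ^ (2 * 1) ≤ (7 : ℝ) ^ (2 * k) := pow_le_pow_right₀ (by norm_num) (by omega)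
    norm_num at h1
    exact h1
  have hpos : (0 : ℝ) < (7 : ℝ) ^ (2 * k) - 16 := by linarith
  have hlt : Real.log ((7 : ℝ) ^ (2 * k) - 16) < Real.log ((7 : ℝ) ^ (2 * k)) :=
    Real.log_lt_log hpos (by linarith)
  rw [Real.log_pow] at hlt
  have hk' : (1 : ℝ) ≤ k := by exact_mod_cast hk
  push_cast at hlt
  nlinarith

/-- **D-0121 Q2 ON THE K-LINE, EVERY k: THE l-WINDOW IS EMPTY.** `l ≥ 11` prime, `1 ≤ ε ≤ 30` (the strip of record, `ε ∣ 30`), `k ≥ 1`, `d ≥ 1`: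
if the row-8 top cell holds at the untied `r♯(7, l·ε)` («λ_k ∈ Σ₈ at l», the height-class door's hypothesis on this family, cell-model level), then
`h_k = 2k·log 7 + 2·log(7^{2k} − 16) < 120·(2¹²·3³·5·d)·l` — the l-linear term of the content-locus certificate's l-side condition ALONE exceeds
the height, so «l admissible for the door (l ≥ l₀⁸(k)) ∧ l-linear error < height» has NO solution l, for every k: by `k_le_of_topCell`
(`k ≤ 3lε + 3 ≤ 90l + 3`) and `klineHeight_lt` (`h_k < 36k ≤ 3240·l + 108 < 66355200·d·l`). Complements the finite bed table of record
(abc-iut-rh-num-1 Q3-LWINDOW f4ed31c292e2a89f: EMPTY 253/253) on the one family with unbounded height. Nothing asserts abc. [folklore] -/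
theorem kline_window_empty {l ε k d : ℕ} (hl : l.Prime) (h11 : 11 ≤ l) (hε : 1 ≤ ε) (hε30 : ε ≤ 30) (hk : 1 ≤ k) (hd : 1 ≤ d)
    (hmem : ∀ r : ℤ, StrictMinPow 7 (l * ε) r →
      ((((l / 2 : ℕ) : ℤ)) ^ 2 - 1) * ((k : ℤ) * ε) ≤ ((l / 2 : ℕ) : ℤ) * (((l * ε : ℕ) : ℤ) - r) + (1 - r)) :
    2 * (k : ℝ) * Real.log 7 + 2 * Real.log ((7 : ℝ) ^ (2 * k) - 16) < 120 * (2 ^ 12 * 3 ^ 3 * 5 * (d : ℝ) * l) := by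
  have hkle : (k : ℤ) ≤ 3 * (l : ℤ) * ε + 3 := k_le_of_topCell hl h11 hε hmem
  have hkR : (k : ℝ) ≤ 3 * (l : ℝ) * ε + 3 := by exact_mod_cast hkle
  have hεR : (ε : ℝ) ≤ 30 := by exact_mod_cast hε30
  have hlR : (11 : ℝ) ≤ l := by exact_mod_cast h11
  have hdR : (1 : ℝ) ≤ d := by exact_mod_cast hd
  have hh := klineHeight_lt hk
  have hl0 : (0 : ℝ) ≤ l := by positivity
  nlinarith [mul_le_mul_of_nonneg_left hεR (by positivity : (0 : ℝ) ≤ 3 * (l : ℝ)),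
    mul_le_mul_of_nonneg_right hdR hl0]

/-- **Small-k half needs no membership at all:** for `1 ≤ k ≤ 2·10⁷` (the tabulated K-line stops at `k = 100`) the window is empty at EVERY
prime `l ≥ 11` and every `d ≥ 1`, since `36k ≤ 7.2·10⁸ < 120·552960·11`; Σ₈-membership (`kline_window_empty`) is what closes `k > 2·10⁷`. [folklore] -/
theorem kline_window_empty_of_k_le {l k d : ℕ} (h11 : 11 ≤ l) (hk : 1 ≤ k) (hk' : k ≤ 20000000) (hd : 1 ≤ d) :
    2 * (k : ℝ) * Real.log 7 + 2 * Real.log ((7 : ℝ) ^ (2 * k) - 16) < 120 * (2 ^ 12 * 3 ^ 3 * 5 * (d : ℝ) * l) := by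
  have hh := klineHeight_lt hk
  have hkR : (k : ℝ) ≤ 20000000 := by exact_mod_cast hk'
  have hlR : (11 : ℝ) ≤ l := by exact_mod_cast h11
  have hdR : (1 : ℝ) ≤ d := by exact_mod_cast hd
  have hl0 : (0 : ℝ) ≤ l := by positivity
  nlinarith [mul_le_mul_of_nonneg_right hdR hl0]

/-- **By-name packaging against the certificate's hypothesis SHAPE.** Under the hypotheses of `kline_window_empty`, for ANY real `logQ ≤ h_k`
(the pens take `log q^{∤2}(λ_k) ≤ h_k`) and ANY nonnegative leading term `A` (in `Conditional/AbcExpOfSigmaMassContent` it is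
`6·((1 + 20·dmod/l)·(logDiff + logCond))`), the l-side condition «`A + 120·(2¹²·3³·5·d·l) < logQ`» FAILS. So on the K-line the composed
reading «door-8 hypothesis ∧ content-locus l-condition» is uninhabited for every `k`, `l`, `ε ≤ 30`, `d` — cell-model level, nothing asserts abc. [folklore] -/
theorem kline_not_hregC_shape {l ε k d : ℕ} (hl : l.Prime) (h11 : 11 ≤ l) (hε : 1 ≤ ε) (hε30 : ε ≤ 30) (hk : 1 ≤ k) (hd : 1 ≤ d)
    (hmem : ∀ r : ℤ, StrictMinPow 7 (l * ε) r →
      ((((l / 2 : ℕ) : ℤ)) ^ 2 - 1) * ((k : ℤ) * ε) ≤ ((l / 2 : ℕ) : ℤ) * (((l * ε : ℕ) : ℤ) - r) + (1 - r))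
    {A logQ : ℝ} (hA : 0 ≤ A) (hQ : logQ ≤ 2 * (k : ℝ) * Real.log 7 + 2 * Real.log ((7 : ℝ) ^ (2 * k) - 16)) :
    ¬ (A + 120 * (2 ^ 12 * 3 ^ 3 * 5 * (d : ℝ) * l) < logQ) := by
  have h := kline_window_empty hl h11 hε hε30 hk hd hmem
  intro hlt
  linarith

section RatPoint

open Literature.IUT.LogVolume Literature.IUT.LogVolume.Cor22
open Literature.NumberTheory.DiophantineGeometry Literature.NumberTheory.DiophantineGeometry.GenEll

/-- **GENUINE-DATUM FORM (every k): under Σ₈-membership the bare l-linear term beats `log q^{∤{2,l}}(λ_k)`.** `l ≥ 11` prime, `1 ≤ ε ≤ 30`, `k ≥ 1`: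
if the row-8 top cell holds at the untied `r♯(7, l·ε)` with `m_q = k·ε`, then for the point `P = ratPoint λ_k`, `λ_k = 1/2 + 2/7^k`:
`logQAvoid P {2, l} < 120·(2¹²·3³·5·dmod P)·l`. Route: `k ≤ 3lε + 3 ≤ 90l + 3` (`k_le_of_topCell`); `logQAvoid P {2,l} ≤ logQForall P ≤ 6k·log 7 + 12·log 2`
(abc-iut-w5-d044's `Cor22.logQForall_ratPoint_lamSeven_le`, via `Cor22.logQAvoid_le_logQNotTwo_le`) `≤ 36k + 12 ≤ 3240·l + 120 < 66 355 200·l ≤ 120·552960·dmod P·l`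
(`Cor22.dmod_pos`). Hence the content guard of the Thm-1.10 display (whose left side adds a nonnegative conductor term to the l-linear term) fails at
`(λ_k, l)` whenever «λ_k ∈ Σ₈ at l» — the membership-first twin of abc-iut-lwin-typ-1's content-first `RH.LWindowTable.kline_lwindow_empty` (R31).
Local type `e_w = l·ε(k)`, `ε(k) ∣ 30` at the places of a genuine Θ-datum over `7` is abc-iut-W-num-3's law, an INPUT range here. Nothing asserts abc;
no side taken on [IUTchIII] Cor. 3.12 / [IUTchIV] Thm. 1.10. [claim: Mochizuki2012, status: disputed] for the reading; [folklore] arithmetic. -/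
theorem kline_window_empty_ratPoint {l ε k : ℕ} (hl : l.Prime) (h11 : 11 ≤ l) (hε : 1 ≤ ε) (hε30 : ε ≤ 30) (hk : 1 ≤ k)
    (hmem : ∀ r : ℤ, StrictMinPow 7 (l * ε) r →
      ((((l / 2 : ℕ) : ℤ)) ^ 2 - 1) * ((k : ℤ) * ε) ≤ ((l / 2 : ℕ) : ℤ) * (((l * ε : ℕ) : ℤ) - r) + (1 - r)) :
    logQAvoid (ratPoint ((2 : ℚ)⁻¹ + 2 / 7 ^ k)) {2, l}
      < 120 * (2 ^ 12 * 3 ^ 3 * 5 * (dmod (ratPoint ((2 : ℚ)⁻¹ + 2 / 7 ^ k)) : ℝ) * l) := by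
  set P : NFPoint := ratPoint ((2 : ℚ)⁻¹ + 2 / 7 ^ k) with hP
  have hkle : (k : ℤ) ≤ 3 * (l : ℤ) * ε + 3 := k_le_of_topCell hl h11 hε hmem
  have hkR : (k : ℝ) ≤ 3 * (l : ℝ) * ε + 3 := by exact_mod_cast hkle
  have hεR : (ε : ℝ) ≤ 30 := by exact_mod_cast hε30
  have hlR : (11 : ℝ) ≤ l := by exact_mod_cast h11
  have hl0 : (0 : ℝ) ≤ l := by positivity
  have hD1 : (1 : ℝ) ≤ (dmod P : ℝ) := by exact_mod_cast dmod_pos P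
  have hq : logQAvoid P {2, l} ≤ 6 * (k : ℝ) * Real.log 7 + 12 * Real.log 2 :=
    ((logQAvoid_le_logQNotTwo_le P l).1.trans (logQAvoid_le_logQNotTwo_le P l).2).trans (logQForall_ratPoint_lamSeven_le hk)
  have hlog7 : Real.log 7 ≤ 6 := by
    have := Real.log_le_sub_one_of_pos (show (0 : ℝ) < 7 by norm_num)
    linarith
  have hlog2 : Real.log 2 ≤ 1 := by
    have := Real.log_le_sub_one_of_pos (show (0 : ℝ) < 2 by norm_num)
    linarith
  have hk0 : (0 : ℝ) ≤ k := by positivity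
  have h36 : 6 * (k : ℝ) * Real.log 7 + 12 * Real.log 2 ≤ 36 * k + 12 := by nlinarith
  nlinarith [mul_le_mul_of_nonneg_left hεR (by positivity : (0 : ℝ) ≤ 3 * (l : ℝ)),
    mul_le_mul_of_nonneg_right hD1 hl0]

end RatPoint

end Summit.ABC.IUTFork.Repair.RHHeightClass.KLine
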